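import Literature.AlgebraicGeometry.Motives.AbelianVarietyProduct
import Literature.AlgebraicGeometry.Motives.AbelianVarietyProductDimProofs
import Literature.AlgebraicGeometry.Motives.HyperbolicWeilType
import Literature.AlgebraicGeometry.HodgeTheory.RationalHodgeClasses
import Literature.AlgebraicGeometry.HodgeTheory.AlgebraicClasses
import Literature.AlgebraicGeometry.HodgeTheory.WeilClassesSurfacesProofs
import Literature.AlgebraicGeometry.HodgeTheory.WeilClassesSurfacesAlgebraic
import Summits.HodgeConjecture.HodgeConjecture.Theorems.HeckePrymWeilAimedDescendingRationalModel
import Summits.HodgeConjecture.HodgeConjecture.Theorems.HeckePrymWeilAimedDescendingProductFrame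
import HarnessLib

/-!
# Crux `WeilTwelvefoldsSqrtMinus7` (stmt-HodgeConjecture-1261), line `amnesic-secant-sheaves-split-fourteenfolds` — helper for stub `stub_aimedSplitProductFact`

The registered stub `stub_aimedSplitProductFact` (S7) of the line is, verbatim, the Literature named
fact `Motives.exists_cmWeilSurface_aimedSplitProduct_of_ne_one_of_ne_three` (the aiming lemma of the
Schoen/Koike/Markman product trick; Markman arXiv:2509.23403 §11.5 Step 2, van Geemen LNM 1594
Lemma 5.2 (3), 5.3, 5.4, Schoen Compositio 114 (1998) §10). It has two halves: a Weil SURFACE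
`(B, ψ)` carrying a DESCENT PAIR, and the AIMING of the product `A × B` for every Weil-type `(A, φ)`.
This file PROVES the surface half, for every `d > 0`, on the tree's real carriers and from theorems
of the tree only (`exists_weilSurface_descentPair`):

* the surface is the companion Weil surface `B = E_i × E_i`, `ψ = ((0, -d), (1, 0))` of
  `HodgeTheory/WeilClassesSurfacesAlgebraic` (`exists_weilType_abelianSurfaces_algebraic`: a rational,
  ALGEBRAIC class `b = pr₁^* ω - d · pr₂^* ω` of Hodge type `(1,1)` in the Weil plane
  `weilClassesOf B ψ 1 d = E₊ ⊔ E₋`, with `b ⌣ b ≠ 0`);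
* the descent pair is `(b₊, b₋, η) = (` the `E₊`- and `E₋`-components of `b`, `b` itself `)`:
  `b_± ∈ Eig((𝟙 + ψ)^*, (1 ± i√d)²)` is the eigen-condition of `E_±` at the test endomorphism
  `1·𝟙 + 1·ψ`, and **`b₊ ⌣ b ≠ 0`, `b₋ ⌣ b ≠ 0`** because `b₊ ⌣ b₊ = 0 = b₋ ⌣ b₋`, whence
  `b ⌣ b = 2 · b₊ ⌣ b₋` and `b_± ⌣ b = b₊ ⌣ b₋ ≠ 0`. The vanishing `b₊ ⌣ b₊ = 0` is read off the LINE
  `H⁴(B(ℂ); ℂ)` (Poincaré duality, `finrank_complexBetti_two_add_two_mul_eq_one`): the test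
  endomorphism `(𝟙 + 2ψ)^*` acts on it by a RATIONAL scalar (it preserves the rational line spanned by
  a non-zero rational top class), while `b₊ ⌣ b₊` is an eigenvector of eigenvalue `(1 + 2i√d)⁴ ∉ ℚ`
  (`(1 + 2i√d)² = (1 - 4d) + 4i√d` has non-zero real and imaginary parts, so its square is not real).

The aiming half is NOT here: it is the open part of the named fact (CM elliptic curve `E₀ = ℂ/O_K`
with `[√-d]` as an `AbelianVariety ℂ` endomorphism, Hodge–Riemann signature of the degree-one model of
an arbitrary Weil-type `(A, φ)`, hyperplane classes of weighted Segre embeddings; see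
`Theorems/HeckePrymWeilAimedDescendingProductFrame`, `…IsotropicGlue`).
-/

noncomputable section

set_option linter.dupNamespace false

open CategoryTheory Complex
open Literature.AlgebraicGeometry Literature.AlgebraicGeometry.Motives
  Literature.AlgebraicGeometry.HodgeTheory Literature.AlgebraicTopology.SingularHomology

namespace Summit.HodgeConjecture.HodgeConjecture.Theorems.WeilTwelvefoldsSqrtMinus7.AmnesicSecantSheaves

/-- In a line, an endomorphism is the scalar by which it acts on any non-zero vector. [folklore] -/
private theorem apply_eq_smul_of_finrank_eq_one {V : Type*} [AddCommGroup V] [Module ℂ V]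
    (h1 : Module.finrank ℂ V = 1) {ω : V} (hω0 : ω ≠ 0) (T : V →ₗ[ℂ] V) {q : ℂ}
    (hT : T ω = q • ω) (v : V) : T v = q • v := by
  obtain ⟨c, rfl⟩ := (finrank_eq_one_iff_of_nonzero' ω hω0).1 h1 v
  rw [map_smul, hT, smul_comm]

/-- A common eigenvector for two distinct eigenvalues is zero. [folklore] -/
private theorem eq_zero_of_eigen_ne {V : Type*} [AddCommGroup V] [Module ℂ V] {v w : V} {a b : ℂ}
    (hv1 : w = a • v) (hv2 : w = b • v) (hab : a ≠ b) : v = 0 := by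
  have h : (a - b) • v = 0 := by rw [sub_smul, ← hv1, ← hv2, sub_self]
  exact (smul_eq_zero.1 h).resolve_left (sub_ne_zero.2 hab)

/-- `(a + bi)² ∉ ℚ` for real `a, b ≠ 0` (its imaginary part is `2ab ≠ 0`). [folklore] -/
private theorem sq_ne_ratCast {a b : ℝ} (ha : a ≠ 0) (hb : b ≠ 0) (q : ℚ) :
    ((a : ℂ) + (b : ℂ) * I) * ((a : ℂ) + (b : ℂ) * I) ≠ ((q : ℚ) : ℂ) := by
  intro h
  have him := congrArg Complex.im h
  simp only [Complex.mul_im, Complex.add_re, Complex.ofReal_re, Complex.mul_re, Complex.I_re,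
    mul_zero, Complex.ofReal_im, Complex.I_im, mul_one, sub_self, add_zero, Complex.add_im,
    zero_add, Complex.ratCast_im] at him
  have h2 : a * b = 0 := by linarith
  rcases mul_eq_zero.1 h2 with h0 | h0
  · exact ha h0
  · exact hb h0

/-- `(1 ± 2i√d)² = (1 - 4d) ± 4√d · i` with `1 - 4d ≠ 0`, `4√d ≠ 0` for `d ≥ 1`, hence
`(1 ± 2i√d)⁴ ∉ ℚ`. [folklore] -/
private theorem weilTestCharacter_one_two_sq_ne_ratCast {d : ℕ} (hd : 0 < d) (ε : ℝ) (hε : ε = 1 ∨ ε = -1)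
    (q : ℚ) :
    (((1 : ℕ) : ℂ) + (ε : ℂ) * ((2 : ℕ) : ℂ) * I * (Real.sqrt d : ℂ)) ^ (2 * 1) *
      (((1 : ℕ) : ℂ) + (ε : ℂ) * ((2 : ℕ) : ℂ) * I * (Real.sqrt d : ℂ)) ^ (2 * 1) ≠ ((q : ℚ) : ℂ) := by
  have hsq : ((Real.sqrt d : ℝ) : ℂ) * (Real.sqrt d : ℂ) = (d : ℂ) := by
    rw [← Complex.ofReal_mul, Real.mul_self_sqrt (Nat.cast_nonneg d), Complex.ofReal_natCast]
  have hε2 : (ε : ℂ) * ε = 1 := by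
    rcases hε with rfl | rfl <;> push_cast <;> norm_num
  have ha : (1 - 4 * (d : ℝ)) ≠ 0 := by
    have : (1 : ℝ) ≤ d := by exact_mod_cast hd
    intro h; linarith
  have hb : ε * (4 * Real.sqrt d) ≠ 0 := by
    have hs : 0 < Real.sqrt d := Real.sqrt_pos.2 (by exact_mod_cast hd)
    rcases hε with rfl | rfl <;> intro h <;> linarith
  have key : (((1 : ℕ) : ℂ) + (ε : ℂ) * ((2 : ℕ) : ℂ) * I * (Real.sqrt d : ℂ)) ^ (2 * 1) =
      ((1 - 4 * (d : ℝ) : ℝ) : ℂ) + ((ε * (4 * Real.sqrt d) : ℝ) : ℂ) * I := by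
    push_cast
    linear_combination (4 * (ε : ℂ) ^ 2 * I ^ 2) * hsq + (4 * (d : ℂ) * (ε : ℂ) ^ 2) * I_mul_I
      - (4 * (d : ℂ)) * hε2
  rw [key]
  exact sq_ne_ratCast ha hb q

/-- **The cup-product half of the descent pair on a Weil surface.** On a complex abelian surface `B`
with an endomorphism `ψ` and `d ≥ 1`, let `b₊ ∈ E₊ = weilClassesPlus B ψ 1 d`,
`b₋ ∈ E₋ = weilClassesMinus B ψ 1 d` (simultaneous eigenclasses of all `(x·𝟙 + y·ψ)^*` on `H²` with
characters `(x ± iy√d)²`) with `(b₊ + b₋) ⌣ (b₊ + b₋) ≠ 0`. Then `b₊ ⌣ (b₊ + b₋) ≠ 0` and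
`b₋ ⌣ (b₊ + b₋) ≠ 0`. Indeed `b₊ ⌣ b₊ = 0 = b₋ ⌣ b₋`: `H⁴(B(ℂ); ℂ)` is a line spanned by a rational
class, on which `(𝟙 + 2ψ)^*` is a RATIONAL scalar, whereas `b_± ⌣ b_±` is an eigenvector of eigenvalue
`(1 ± 2i√d)⁴ ∉ ℚ`; so `(b₊ + b₋)² = 2 b₊ ⌣ b₋ ≠ 0` (graded commutativity) and
`b_± ⌣ (b₊ + b₋) = b₊ ⌣ b₋`. (Schoen, Compositio 114 (1998) §10: "`ω_{5,σ₁} ∧ ω_{6,σ₁} ∧ ω_{5,σ₂} ∧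
ω_{6,σ₂}` is a basis for `H⁴(A'; ℂ)`", in cohomological form on the tree's carriers.)
[cite: Schoen1998HodgeWeilAddendum, §10 (proof of the Proposition, p. 333)] -/
theorem cupProduct_weilPlus_ne_zero_and_cupProduct_weilMinus_ne_zero {B : AbelianVariety ℂ}
    {ψ : B ⟶ B} (hB : B.dim = 2) {d : ℕ} (hd : 0 < d) (h4 : 2 * 1 + 2 * 1 = 2 * (2 * 1))
    {bp bm : complexBetti B.X (2 * 1)} (hbp : bp ∈ weilClassesPlus B ψ 1 d)
    (hbm : bm ∈ weilClassesMinus B ψ 1 d) (hbb : cupProduct h4 (bp + bm) (bp + bm) ≠ 0) :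
    cupProduct h4 bp (bp + bm) ≠ 0 ∧ cupProduct h4 bm (bp + bm) ≠ 0 := by
  -- the test endomorphism `𝟙 + 2ψ` and its characters on `E±`
  set f := Motives.AlgPoints.mapContinuous (L := ℂ) ((1 : ℕ) • 𝟙 B + (2 : ℕ) • ψ).hom.hom.hom with hf
  set lp : ℂ := (((1 : ℕ) : ℂ) + ((2 : ℕ) : ℂ) * Complex.I * (Real.sqrt d : ℂ)) ^ (2 * 1) with hlp
  set lm : ℂ := (((1 : ℕ) : ℂ) - ((2 : ℕ) : ℂ) * Complex.I * (Real.sqrt d : ℂ)) ^ (2 * 1) with hlm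
  have ebp : singularCohomology.map ℂ ℂ f (2 * 1) bp = lp • bp := (mem_weilClassesPlus_iff.1 hbp) 1 2
  have ebm : singularCohomology.map ℂ ℂ f (2 * 1) bm = lm • bm := (mem_weilClassesMinus_iff.1 hbm) 1 2
  -- `H⁴(B(ℂ); ℂ)` is a line on which `f^*` is a rational scalar `q`
  have hX : IsSmoothProjective (1 + 1) B.X := isSmoothProjective_of_dim_eq' hB
  have h1 : Module.finrank ℂ (complexBetti B.X (2 * (2 * 1))) = 1 :=
    finrank_complexBetti_two_add_two_mul_eq_one (j := 1) hX
  obtain ⟨ω, hω, hω0⟩ : ∃ ω : complexBetti B.X (2 * (2 * 1)), IsRationalClass ω ∧ ω ≠ 0 :=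
    exists_isRationalClass_ne_zero_two_add_two_mul (j := 1) hX
  obtain ⟨q, hq⟩ := exists_eq_ratCast_smul_of_finrank_eq_one h1 hω hω0 (hω.map f)
  have hT : ∀ v : complexBetti B.X (2 * (2 * 1)),
      singularCohomology.map ℂ ℂ f (2 * (2 * 1)) v = ((q : ℚ) : ℂ) • v :=
    apply_eq_smul_of_finrank_eq_one h1 hω0 (singularCohomology.map ℂ ℂ f (2 * (2 * 1))).hom hq
  -- `b₊ ⌣ b₊ = 0`, `b₋ ⌣ b₋ = 0`
  have fpp : singularCohomology.map ℂ ℂ f (2 * (2 * 1)) (cupProduct h4 bp bp) = (lp * lp) • cupProduct h4 bp bp := by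
    rw [cupProduct_map, ebp, map_smul, map_smul, LinearMap.smul_apply, smul_smul]
  have fmm : singularCohomology.map ℂ ℂ f (2 * (2 * 1)) (cupProduct h4 bm bm) = (lm * lm) • cupProduct h4 bm bm := by
    rw [cupProduct_map, ebm, map_smul, map_smul, LinearMap.smul_apply, smul_smul]
  have hlp2 : lp * lp ≠ ((q : ℚ) : ℂ) := by
    have e : lp = (((1 : ℕ) : ℂ) + ((1 : ℝ) : ℂ) * ((2 : ℕ) : ℂ) * I * (Real.sqrt d : ℂ)) ^ (2 * 1) := by
      rw [hlp]; push_cast; ring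
    rw [e]
    exact weilTestCharacter_one_two_sq_ne_ratCast hd 1 (Or.inl rfl) q
  have hlm2 : lm * lm ≠ ((q : ℚ) : ℂ) := by
    have e : lm = (((1 : ℕ) : ℂ) + ((-1 : ℝ) : ℂ) * ((2 : ℕ) : ℂ) * I * (Real.sqrt d : ℂ)) ^ (2 * 1) := by
      rw [hlm]; push_cast; ring
    rw [e]
    exact weilTestCharacter_one_two_sq_ne_ratCast hd (-1) (Or.inr rfl) q
  have hpp : cupProduct h4 bp bp = 0 := eq_zero_of_eigen_ne fpp (hT _) hlp2
  have hmm : cupProduct h4 bm bm = 0 := eq_zero_of_eigen_ne fmm (hT _) hlm2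
  -- graded commutativity in even degree and the expansion of `(b₊ + b₋)²`
  have hcomm : cupProduct h4 bm bp = cupProduct h4 bp bm := by
    rw [cupProduct_gradedComm_holds ℂ _ h4 h4 bm bp]
    norm_num
  have hsq : cupProduct h4 (bp + bm) (bp + bm) = (2 : ℂ) • cupProduct h4 bp bm := by
    simp only [map_add, LinearMap.add_apply, hpp, hmm, hcomm, zero_add, add_zero]
    rw [two_smul]
  have hx : cupProduct h4 bp bm ≠ 0 := fun h0 => hbb (by rw [hsq, h0, smul_zero])
  constructor
  · rw [map_add, hpp, zero_add]
    exact hx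
  · rw [map_add, hcomm, hmm, add_zero]
    exact hx

/-- **A Weil surface with a descent pair, for every `K = ℚ(√-d)` — the surface half of the aiming
lemma `Motives.exists_cmWeilSurface_aimedSplitProduct_of_ne_one_of_ne_three` (registered stub
`stub_aimedSplitProductFact` of line `amnesic-secant-sheaves-split-fourteenfolds`, crux
stmt-HodgeConjecture-1261), PROVED.** For every `d ≥ 1` there is a complex abelian surface `B` with
an endomorphism `ψ`, `ψ ≫ ψ = -d`, and classes `b₊ ∈ Eig((𝟙 + ψ)^*, (1 + i√d)²)`,
`b₋ ∈ Eig((𝟙 + ψ)^*, (1 - i√d)²)` of `H²(B(ℂ); ℂ)` with `b₊ + b₋` RATIONAL of Hodge type `(1,1)`, and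
an ALGEBRAIC class `η ∈ N¹H²(B(ℂ); ℂ)` with `b₊ ⌣ η ≠ 0` and `b₋ ⌣ η ≠ 0` in `H⁴(B(ℂ); ℂ)`. Witness:
the companion Weil surface `B = E_i × E_i`, `ψ = ((0, -d), (1, 0))`, `η = b₊ + b₋ = pr₁^* ω - d · pr₂^* ω`
the algebraic divisor class of `exists_weilType_abelianSurfaces_algebraic` (its `E_±`-components are
the `b_±`), and `cupProduct_weilPlus_ne_zero_and_cupProduct_weilMinus_ne_zero`. In print (Schoen,
Compositio 114 (1998) §10; van Geemen LNM 1594, 5.3; Markman arXiv:2509.23403 §11.5 Step 2) the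
surface is `E₀ × E₀` with `E₀ = ℂ/O_K` and `η = [Δ]`; the companion surface needs no CM.
[cite: Schoen1998HodgeWeilAddendum, §10 (proof of the Proposition, p. 333)]
[cite: vanGeemen1994HodgeAV, 5.3 and Lemma 5.2 (6)] -/
theorem exists_weilSurface_descentPair :
    ∀ d : ℕ, 0 < d →
    ∃ (B : AbelianVariety ℂ) (ψ : B ⟶ B), B.dim = 2 ∧ ψ ≫ ψ = -((d : ℤ) • 𝟙 B) ∧
      (∃ bp bm η : complexBetti B.X 2,
        bp ∈ Module.End.eigenspace (complexBetti.map (𝟙 B + ψ).hom.hom.hom 2).hom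
              ((1 + Complex.I * (Real.sqrt (d : ℝ) : ℂ)) ^ 2) ∧
        bm ∈ Module.End.eigenspace (complexBetti.map (𝟙 B + ψ).hom.hom.hom 2).hom
              ((1 - Complex.I * (Real.sqrt (d : ℝ) : ℂ)) ^ 2) ∧
        IsRationalClass (bp + bm) ∧ IsOfHodgeType 2 B.X 2 1 1 (bp + bm) ∧
        η ∈ algebraicClasses B.X 1 ∧
        cupProduct (show 2 + 2 = 4 from rfl) bp η ≠ 0 ∧
        cupProduct (show 2 + 2 = 4 from rfl) bm η ≠ 0) := by
  intro d hd
  obtain ⟨B, ψ, b, hB, hψ, hrat, hH, hW, halg, hbb⟩ := exists_weilType_abelianSurfaces_algebraic d hd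
  rw [weilClassesOf] at hW
  obtain ⟨bp, hbp, bm, hbm, rfl⟩ := Submodule.mem_sup.1 hW
  obtain ⟨hp, hm⟩ := cupProduct_weilPlus_ne_zero_and_cupProduct_weilMinus_ne_zero hB hd _ hbp hbm hbb
  have hone : ((1 : ℕ) • 𝟙 B + (1 : ℕ) • ψ : B ⟶ B) = 𝟙 B + ψ := by simp
  have hsqrt : (((1 : ℕ) : ℂ) + ((1 : ℕ) : ℂ) * Complex.I * (Real.sqrt d : ℂ)) ^ (2 * 1) =
      (1 + Complex.I * (Real.sqrt (d : ℝ) : ℂ)) ^ 2 := by push_cast; ring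
  have hsqrt' : (((1 : ℕ) : ℂ) - ((1 : ℕ) : ℂ) * Complex.I * (Real.sqrt d : ℂ)) ^ (2 * 1) =
      (1 - Complex.I * (Real.sqrt (d : ℝ) : ℂ)) ^ 2 := by push_cast; ring
  refine ⟨B, ψ, hB, by rw [natCast_zsmul]; exact hψ, bp, bm, bp + bm, ?_, ?_, hrat, hH, halg, hp, hm⟩
  · rw [Module.End.mem_eigenspace_iff]
    have h := (mem_weilClassesPlus_iff.1 hbp) 1 1
    rw [hone, hsqrt] at h
    exact h
  · rw [Module.End.mem_eigenspace_iff]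
    have h := (mem_weilClassesMinus_iff.1 hbm) 1 1
    rw [hone, hsqrt'] at h
    exact h

end Summit.HodgeConjecture.HodgeConjecture.Theorems.WeilTwelvefoldsSqrtMinus7.AmnesicSecantSheaves

end
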